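import Summits.ValiantsHypothesis.ValiantsHypothesis.Theorems.KPlusLogSqLawStaticTridiagonalThreeByThree

/-!
# FOUR-BY-FOUR LAW for ALL static definite tridiagonal designs: at most FOUR positive determinant zeros (Part 6)

HONEST FRAMING.  Helper theorem (`--supports stmt-ValiantsHypothesis-19561 --as helper`; seat val-sym-lift-p2 g9, cell `pub-symmetroid`,
2026-08-27) on the REAL side of the desk's typed α target (lead R2102/R2114).  Part 4 proved `Z ≤ 4` for IRREDUCIBLE `4 × 4` designs
from the bottom- and top-class laws; this file removes the irreducibility hypothesis: **every** real symmetric tridiagonal `4 × 4` matrix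
of monomials with positive diagonal coefficients has at most four distinct positive determinant zeros (located sharp value `3`, not
claimed).  Cases: `c₂₃ = 0` — the zeros are those of the leading `3 × 3` design (Part 5's three-by-three law); `c₀₁ = 0` — the same after
reversal; `c₁₂ = 0` — the continuant factors as `(L₃ L₂ − w₂) · K₂`, two monomial-equation branches with at most one positive zero each;
all links non-zero — Part 4.  Calibration row; nothing here bears on `WeakLifting` (stmt-19561) / `TropicalB` (stmt-19771) in their windows,
Conjecture B, the Door-A registers, `MatrixDescartes` (stmt-ValiantsHypothesis-18050) or VP ≠ VNP.

WHAT IS PROVED.  **`card_posRoots_four_le_four_all`** — the FOUR-BY-FOUR LAW for all designs, in R2102's count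
`(det (of fun i j => C (c i j) * X ^ e i j)).roots.toFinset.filter (0 < ·)`.  Appendix (all sizes, the CLASS RANGE used on paper
throughout this series): `pivot_pos_of_prev_neg` — two consecutive LDLᵀ pivots are never both negative (so the matrix has at least `⌈m/2⌉`
positive eigenvalues); `prevPivot_pos_of_root` — at a determinant zero the last proper pivot is positive (so the negative pivots of a zero
of class `j` sit among the positions `2, …, m − 2`, pairwise non-adjacent: `j ≤ ⌊m/2⌋ − 1`; the counting is left on paper).
[folklore: continuants; this seat's Parts 2–5.]
-/

set_option linter.dupNamespace false
set_option autoImplicit false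

namespace Summit.ValiantsHypothesis.ValiantsHypothesis.Theorems.KPlusLogSqLaw.DefiniteInterpolation

open Summit.ValiantsHypothesis.ValiantsHypothesis.Theorems.ValuativeFlip (ctK ctK_zero ctK_one ctK_two ctK_add_two)
open Polynomial

section ReducibleFour

/-- **FOUR-BY-FOUR LAW (all designs): every static definite tridiagonal `4 × 4` design has at most FOUR positive determinant zeros.**
Irreducible: `card_posRoots_four_le_four`.  `c₂₃ = 0`: the zeros are those of the leading `3 × 3` design (at most two by the
three-by-three law); `c₀₁ = 0`: the same after reversal; `c₁₂ = 0`: the continuant factors as `(L₃L₂ − w₂) · K₂` and each factor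
vanishes on a monomial equation (at most one positive solution each unless the determinant vanishes identically). [this file] -/
theorem card_posRoots_four_le_four_all (c : Fin 4 → Fin 4 → ℝ) (e : Fin 4 → Fin 4 → ℕ) (hc : ∀ i j, c i j = c j i)
    (hband : ∀ i j : Fin 4, (i : ℕ) + 1 < j ∨ (j : ℕ) + 1 < i → c i j = 0) (hpos : ∀ i, 0 < c i i) :
    ((Matrix.det (Matrix.of fun i j => C (c i j) * (X : ℝ[X]) ^ e i j)).roots.toFinset.filter
      (fun t : ℝ => 0 < t)).card ≤ 4 := by
  -- (i) the case `c₂₃ = 0`, for an arbitrary design `c'` of size 4: reduce to the leading 3 × 3 design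
  have hlast : ∀ (c' : Fin 4 → Fin 4 → ℝ) (e' : Fin 4 → Fin 4 → ℕ), (∀ i j, c' i j = c' j i) →
      (∀ i j : Fin 4, (i : ℕ) + 1 < j ∨ (j : ℕ) + 1 < i → c' i j = 0) → (∀ i, 0 < c' i i) →
      c' ⟨2, by omega⟩ ⟨3, by omega⟩ = 0 →
      ((Matrix.det (Matrix.of fun i j => C (c' i j) * (X : ℝ[X]) ^ e' i j)).roots.toFinset.filter
        (fun t : ℝ => 0 < t)).card ≤ 4 := by
    intro c' e' hc' hband' hpos' h23
    set P := Matrix.det (Matrix.of fun i j => C (c' i j) * (X : ℝ[X]) ^ e' i j) with hP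
    -- the leading 3 × 3 design
    set c₃ : Fin 3 → Fin 3 → ℝ := fun i j => c' (Fin.castLE (by omega) i) (Fin.castLE (by omega) j) with hc₃
    set e₃ : Fin 3 → Fin 3 → ℕ := fun i j => e' (Fin.castLE (by omega) i) (Fin.castLE (by omega) j) with he₃
    set P₃ := Matrix.det (Matrix.of fun i j => C (c₃ i j) * (X : ℝ[X]) ^ e₃ i j) with hP₃
    have hc₃s : ∀ i j, c₃ i j = c₃ j i := fun i j => hc' _ _
    have hband₃ : ∀ i j : Fin 3, (i : ℕ) + 1 < j ∨ (j : ℕ) + 1 < i → c₃ i j = 0 := by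
      intro i j hij; exact hband' _ _ (by simpa using hij)
    have hpos₃ : ∀ i, 0 < c₃ i i := fun i => hpos' _
    -- root transfer: for t > 0, P(t) = 0 ↔ P₃(t) = 0
    have hroots : ∀ t : ℝ, 0 < t → (P.IsRoot t ↔ P₃.IsRoot t) := by
      intro t ht
      have h4 : ctK (fun s : ℕ => if h : s < 4 then c' ⟨s, h⟩ ⟨s, h⟩ * t ^ e' ⟨s, h⟩ ⟨s, h⟩ else 1)
          (fun s : ℕ => -(if h : s + 1 < 4 then c' ⟨s, by omega⟩ ⟨s + 1, h⟩ * t ^ e' ⟨s, by omega⟩ ⟨s + 1, h⟩ else 0))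
          (fun s : ℕ => if h : 1 ≤ s ∧ s < 4 then c' ⟨s, h.2⟩ ⟨s - 1, by omega⟩ * t ^ e' ⟨s, h.2⟩ ⟨s - 1, by omega⟩ else 0) 4 =
          (fun s : ℕ => if h : s < 4 then c' ⟨s, h⟩ ⟨s, h⟩ * t ^ e' ⟨s, h⟩ ⟨s, h⟩ else 1) 3 *
            ctK (fun s : ℕ => if h : s < 4 then c' ⟨s, h⟩ ⟨s, h⟩ * t ^ e' ⟨s, h⟩ ⟨s, h⟩ else 1)
          (fun s : ℕ => -(if h : s + 1 < 4 then c' ⟨s, by omega⟩ ⟨s + 1, h⟩ * t ^ e' ⟨s, by omega⟩ ⟨s + 1, h⟩ else 0))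
          (fun s : ℕ => if h : 1 ≤ s ∧ s < 4 then c' ⟨s, h.2⟩ ⟨s - 1, by omega⟩ * t ^ e' ⟨s, h.2⟩ ⟨s - 1, by omega⟩ else 0) 3 +
          (fun s : ℕ => -(if h : s + 1 < 4 then c' ⟨s, by omega⟩ ⟨s + 1, h⟩ * t ^ e' ⟨s, by omega⟩ ⟨s + 1, h⟩ else 0)) 2 *
            (fun s : ℕ => if h : 1 ≤ s ∧ s < 4 then c' ⟨s, h.2⟩ ⟨s - 1, by omega⟩ * t ^ e' ⟨s, h.2⟩ ⟨s - 1, by omega⟩ else 0) (2 + 1) *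
            ctK (fun s : ℕ => if h : s < 4 then c' ⟨s, h⟩ ⟨s, h⟩ * t ^ e' ⟨s, h⟩ ⟨s, h⟩ else 1)
          (fun s : ℕ => -(if h : s + 1 < 4 then c' ⟨s, by omega⟩ ⟨s + 1, h⟩ * t ^ e' ⟨s, by omega⟩ ⟨s + 1, h⟩ else 0))
          (fun s : ℕ => if h : 1 ≤ s ∧ s < 4 then c' ⟨s, h.2⟩ ⟨s - 1, by omega⟩ * t ^ e' ⟨s, h.2⟩ ⟨s - 1, by omega⟩ else 0) 2 := ctK_add_two _ _ _ 2
      have hMN : (fun s : ℕ => -(if h : s + 1 < 4 then c' ⟨s, by omega⟩ ⟨s + 1, h⟩ * t ^ e' ⟨s, by omega⟩ ⟨s + 1, h⟩ else 0)) 2 *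
            (fun s : ℕ => if h : 1 ≤ s ∧ s < 4 then c' ⟨s, h.2⟩ ⟨s - 1, by omega⟩ * t ^ e' ⟨s, h.2⟩ ⟨s - 1, by omega⟩ else 0) (2 + 1) = 0 := by
        have hw := linkWeight_eq c' e' t 2
        rw [dif_pos (show 2 + 1 < 4 by omega)] at hw
        have h23' : c' ⟨2, by omega⟩ ⟨2 + 1, by omega⟩ = 0 := h23
        rw [h23', zero_mul, zero_mul] at hw
        linarith
      have hL3 : 0 < (fun s : ℕ => if h : s < 4 then c' ⟨s, h⟩ ⟨s, h⟩ * t ^ e' ⟨s, h⟩ ⟨s, h⟩ else 1) 3 := diagSeq_pos c' e' hpos' ht 3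
      have hK3 : ctK (fun s : ℕ => if h : s < 4 then c' ⟨s, h⟩ ⟨s, h⟩ * t ^ e' ⟨s, h⟩ ⟨s, h⟩ else 1)
          (fun s : ℕ => -(if h : s + 1 < 4 then c' ⟨s, by omega⟩ ⟨s + 1, h⟩ * t ^ e' ⟨s, by omega⟩ ⟨s + 1, h⟩ else 0))
          (fun s : ℕ => if h : 1 ≤ s ∧ s < 4 then c' ⟨s, h.2⟩ ⟨s - 1, by omega⟩ * t ^ e' ⟨s, h.2⟩ ⟨s - 1, by omega⟩ else 0) 3 =
          (Matrix.of fun i j : Fin 3 => c₃ i j * t ^ e₃ i j).det := by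
        rw [hc₃, he₃, ← det_leadingBlock_eq_ctK c' e' hband' t (show 3 ≤ 4 by omega)]
      rw [hP, isRoot_iff_ctK_eq_zero c' e' hband' t, h4, hMN, zero_mul, add_zero, hP₃, Polynomial.IsRoot.def,
        eval_det_design c₃ e₃ t, ← hK3]
      constructor
      · intro h
        rcases mul_eq_zero.mp h with h0 | h0
        · exact absurd h0 hL3.ne'
        · exact h0
      · intro h; rw [h, mul_zero]
    by_cases hP₃0 : P₃ = 0
    · -- then every positive real is a root of P, so P = 0 and there are no roots at all
      have hP0 : P = 0 := by
        apply Polynomial.eq_zero_of_infinite_isRoot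
        refine Set.Infinite.mono (fun t (ht : t ∈ Set.Ioi (0 : ℝ)) => (hroots t ht).mpr ?_) (Set.Ioi_infinite 0)
        rw [hP₃0]; exact Polynomial.IsRoot.def.mpr (by simp)
      rw [hP0, Polynomial.roots_zero]
      simp
    · have hsub : P.roots.toFinset.filter (fun t : ℝ => 0 < t) ⊆ P₃.roots.toFinset.filter (fun t : ℝ => 0 < t) := by
        intro t ht
        rw [Finset.mem_filter, Multiset.mem_toFinset, Polynomial.mem_roots'] at ht ⊢
        exact ⟨⟨hP₃0, (hroots t ht.2).mp ht.1.2⟩, ht.2⟩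
      exact le_trans (Finset.card_le_card hsub)
        (le_trans (card_posRoots_three_le_two_all c₃ e₃ hc₃s hband₃ hpos₃) (by norm_num))
  by_cases h23 : c ⟨2, by omega⟩ ⟨3, by omega⟩ = 0
  · exact hlast c e hc hband hpos h23
  by_cases h01 : c ⟨0, by omega⟩ ⟨1, by omega⟩ = 0
  · -- (ii) reverse: the link (0,1) becomes the link (2,3)
    rw [← det_design_rev c e]
    refine hlast (fun i j => c (Fin.rev i) (Fin.rev j)) (fun i j => e (Fin.rev i) (Fin.rev j)) (fun i j => hc _ _)
      (fun i j hij => hband _ _ ?_) (fun i => hpos _) ?_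
    · rcases hij with h | h
      · right; simp only [Fin.val_rev]; omega
      · left; simp only [Fin.val_rev]; omega
    · rw [hc]
      convert h01 using 2 <;> decide
  by_cases h12 : c ⟨1, by omega⟩ ⟨2, by omega⟩ = 0
  · -- (iii) the middle link vanishes: K₄ = (L₃ L₂ − w₂) · K₂, two monomial-equation branches
    set P := Matrix.det (Matrix.of fun i j => C (c i j) * (X : ℝ[X]) ^ e i j) with hP
    -- closed forms at a point t
    have hfact : ∀ t : ℝ, 0 < t → (P.IsRoot t ↔
        (c ⟨1, by omega⟩ ⟨1, by omega⟩ * c ⟨0, by omega⟩ ⟨0, by omega⟩) *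
              t ^ (e ⟨1, by omega⟩ ⟨1, by omega⟩ + e ⟨0, by omega⟩ ⟨0, by omega⟩) =
            (c ⟨0, by omega⟩ ⟨0 + 1, by omega⟩ * c ⟨0 + 1, by omega⟩ ⟨0, by omega⟩) *
              t ^ (e ⟨0, by omega⟩ ⟨0 + 1, by omega⟩ + e ⟨0 + 1, by omega⟩ ⟨0, by omega⟩) ∨
          (c ⟨3, by omega⟩ ⟨3, by omega⟩ * c ⟨2, by omega⟩ ⟨2, by omega⟩) *
              t ^ (e ⟨3, by omega⟩ ⟨3, by omega⟩ + e ⟨2, by omega⟩ ⟨2, by omega⟩) =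
            (c ⟨2, by omega⟩ ⟨2 + 1, by omega⟩ * c ⟨2 + 1, by omega⟩ ⟨2, by omega⟩) *
              t ^ (e ⟨2, by omega⟩ ⟨2 + 1, by omega⟩ + e ⟨2 + 1, by omega⟩ ⟨2, by omega⟩)) := by
      intro t ht
      have hL : ∀ (s : ℕ) (hs : s < 4), (fun s : ℕ => if h : s < 4 then c ⟨s, h⟩ ⟨s, h⟩ * t ^ e ⟨s, h⟩ ⟨s, h⟩ else 1) s =
          c ⟨s, hs⟩ ⟨s, hs⟩ * t ^ e ⟨s, hs⟩ ⟨s, hs⟩ := fun s hs => by simp only [dif_pos hs]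
      have hMN : ∀ (s : ℕ) (hs : s + 1 < 4), (fun s : ℕ => -(if h : s + 1 < 4 then c ⟨s, by omega⟩ ⟨s + 1, h⟩ * t ^ e ⟨s, by omega⟩ ⟨s + 1, h⟩ else 0)) s *
          (fun s : ℕ => if h : 1 ≤ s ∧ s < 4 then c ⟨s, h.2⟩ ⟨s - 1, by omega⟩ * t ^ e ⟨s, h.2⟩ ⟨s - 1, by omega⟩ else 0) (s + 1) =
          -(c ⟨s, by omega⟩ ⟨s + 1, hs⟩ * c ⟨s + 1, hs⟩ ⟨s, by omega⟩ *
            t ^ (e ⟨s, by omega⟩ ⟨s + 1, hs⟩ + e ⟨s + 1, hs⟩ ⟨s, by omega⟩)) := by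
        intro s hs
        have hw := linkWeight_eq c e t s
        rw [dif_pos hs] at hw
        linarith
      have h4 : ctK (fun s : ℕ => if h : s < 4 then c ⟨s, h⟩ ⟨s, h⟩ * t ^ e ⟨s, h⟩ ⟨s, h⟩ else 1)
          (fun s : ℕ => -(if h : s + 1 < 4 then c ⟨s, by omega⟩ ⟨s + 1, h⟩ * t ^ e ⟨s, by omega⟩ ⟨s + 1, h⟩ else 0))
          (fun s : ℕ => if h : 1 ≤ s ∧ s < 4 then c ⟨s, h.2⟩ ⟨s - 1, by omega⟩ * t ^ e ⟨s, h.2⟩ ⟨s - 1, by omega⟩ else 0) 4 =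
          (fun s : ℕ => if h : s < 4 then c ⟨s, h⟩ ⟨s, h⟩ * t ^ e ⟨s, h⟩ ⟨s, h⟩ else 1) 3 *
            ctK (fun s : ℕ => if h : s < 4 then c ⟨s, h⟩ ⟨s, h⟩ * t ^ e ⟨s, h⟩ ⟨s, h⟩ else 1)
          (fun s : ℕ => -(if h : s + 1 < 4 then c ⟨s, by omega⟩ ⟨s + 1, h⟩ * t ^ e ⟨s, by omega⟩ ⟨s + 1, h⟩ else 0))
          (fun s : ℕ => if h : 1 ≤ s ∧ s < 4 then c ⟨s, h.2⟩ ⟨s - 1, by omega⟩ * t ^ e ⟨s, h.2⟩ ⟨s - 1, by omega⟩ else 0) 3 +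
          (fun s : ℕ => -(if h : s + 1 < 4 then c ⟨s, by omega⟩ ⟨s + 1, h⟩ * t ^ e ⟨s, by omega⟩ ⟨s + 1, h⟩ else 0)) 2 *
            (fun s : ℕ => if h : 1 ≤ s ∧ s < 4 then c ⟨s, h.2⟩ ⟨s - 1, by omega⟩ * t ^ e ⟨s, h.2⟩ ⟨s - 1, by omega⟩ else 0) (2 + 1) *
            ctK (fun s : ℕ => if h : s < 4 then c ⟨s, h⟩ ⟨s, h⟩ * t ^ e ⟨s, h⟩ ⟨s, h⟩ else 1)
          (fun s : ℕ => -(if h : s + 1 < 4 then c ⟨s, by omega⟩ ⟨s + 1, h⟩ * t ^ e ⟨s, by omega⟩ ⟨s + 1, h⟩ else 0))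
          (fun s : ℕ => if h : 1 ≤ s ∧ s < 4 then c ⟨s, h.2⟩ ⟨s - 1, by omega⟩ * t ^ e ⟨s, h.2⟩ ⟨s - 1, by omega⟩ else 0) 2 := ctK_add_two _ _ _ 2
      have h3 : ctK (fun s : ℕ => if h : s < 4 then c ⟨s, h⟩ ⟨s, h⟩ * t ^ e ⟨s, h⟩ ⟨s, h⟩ else 1)
          (fun s : ℕ => -(if h : s + 1 < 4 then c ⟨s, by omega⟩ ⟨s + 1, h⟩ * t ^ e ⟨s, by omega⟩ ⟨s + 1, h⟩ else 0))
          (fun s : ℕ => if h : 1 ≤ s ∧ s < 4 then c ⟨s, h.2⟩ ⟨s - 1, by omega⟩ * t ^ e ⟨s, h.2⟩ ⟨s - 1, by omega⟩ else 0) 3 =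
          (fun s : ℕ => if h : s < 4 then c ⟨s, h⟩ ⟨s, h⟩ * t ^ e ⟨s, h⟩ ⟨s, h⟩ else 1) 2 *
            ctK (fun s : ℕ => if h : s < 4 then c ⟨s, h⟩ ⟨s, h⟩ * t ^ e ⟨s, h⟩ ⟨s, h⟩ else 1)
          (fun s : ℕ => -(if h : s + 1 < 4 then c ⟨s, by omega⟩ ⟨s + 1, h⟩ * t ^ e ⟨s, by omega⟩ ⟨s + 1, h⟩ else 0))
          (fun s : ℕ => if h : 1 ≤ s ∧ s < 4 then c ⟨s, h.2⟩ ⟨s - 1, by omega⟩ * t ^ e ⟨s, h.2⟩ ⟨s - 1, by omega⟩ else 0) 2 +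
          (fun s : ℕ => -(if h : s + 1 < 4 then c ⟨s, by omega⟩ ⟨s + 1, h⟩ * t ^ e ⟨s, by omega⟩ ⟨s + 1, h⟩ else 0)) 1 *
            (fun s : ℕ => if h : 1 ≤ s ∧ s < 4 then c ⟨s, h.2⟩ ⟨s - 1, by omega⟩ * t ^ e ⟨s, h.2⟩ ⟨s - 1, by omega⟩ else 0) (1 + 1) *
            ctK (fun s : ℕ => if h : s < 4 then c ⟨s, h⟩ ⟨s, h⟩ * t ^ e ⟨s, h⟩ ⟨s, h⟩ else 1)
          (fun s : ℕ => -(if h : s + 1 < 4 then c ⟨s, by omega⟩ ⟨s + 1, h⟩ * t ^ e ⟨s, by omega⟩ ⟨s + 1, h⟩ else 0))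
          (fun s : ℕ => if h : 1 ≤ s ∧ s < 4 then c ⟨s, h.2⟩ ⟨s - 1, by omega⟩ * t ^ e ⟨s, h.2⟩ ⟨s - 1, by omega⟩ else 0) 1 := ctK_add_two _ _ _ 1
      have h2 : ctK (fun s : ℕ => if h : s < 4 then c ⟨s, h⟩ ⟨s, h⟩ * t ^ e ⟨s, h⟩ ⟨s, h⟩ else 1)
          (fun s : ℕ => -(if h : s + 1 < 4 then c ⟨s, by omega⟩ ⟨s + 1, h⟩ * t ^ e ⟨s, by omega⟩ ⟨s + 1, h⟩ else 0))
          (fun s : ℕ => if h : 1 ≤ s ∧ s < 4 then c ⟨s, h.2⟩ ⟨s - 1, by omega⟩ * t ^ e ⟨s, h.2⟩ ⟨s - 1, by omega⟩ else 0) 2 =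
          (fun s : ℕ => if h : s < 4 then c ⟨s, h⟩ ⟨s, h⟩ * t ^ e ⟨s, h⟩ ⟨s, h⟩ else 1) 1 *
            (fun s : ℕ => if h : s < 4 then c ⟨s, h⟩ ⟨s, h⟩ * t ^ e ⟨s, h⟩ ⟨s, h⟩ else 1) 0 +
          (fun s : ℕ => -(if h : s + 1 < 4 then c ⟨s, by omega⟩ ⟨s + 1, h⟩ * t ^ e ⟨s, by omega⟩ ⟨s + 1, h⟩ else 0)) 0 *
            (fun s : ℕ => if h : 1 ≤ s ∧ s < 4 then c ⟨s, h.2⟩ ⟨s - 1, by omega⟩ * t ^ e ⟨s, h.2⟩ ⟨s - 1, by omega⟩ else 0) (0 + 1) :=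
        ctK_two _ _ _
      have h12' : c ⟨1, by omega⟩ ⟨1 + 1, by omega⟩ = 0 := h12
      -- abbreviations
      set A := c ⟨1, by omega⟩ ⟨1, by omega⟩ * t ^ e ⟨1, by omega⟩ ⟨1, by omega⟩ *
          (c ⟨0, by omega⟩ ⟨0, by omega⟩ * t ^ e ⟨0, by omega⟩ ⟨0, by omega⟩) +
        -(c ⟨0, by omega⟩ ⟨0 + 1, by omega⟩ * c ⟨0 + 1, by omega⟩ ⟨0, by omega⟩ *
          t ^ (e ⟨0, by omega⟩ ⟨0 + 1, by omega⟩ + e ⟨0 + 1, by omega⟩ ⟨0, by omega⟩)) with hA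
      set B := c ⟨3, by omega⟩ ⟨3, by omega⟩ * t ^ e ⟨3, by omega⟩ ⟨3, by omega⟩ *
          (c ⟨2, by omega⟩ ⟨2, by omega⟩ * t ^ e ⟨2, by omega⟩ ⟨2, by omega⟩) +
        -(c ⟨2, by omega⟩ ⟨2 + 1, by omega⟩ * c ⟨2 + 1, by omega⟩ ⟨2, by omega⟩ *
          t ^ (e ⟨2, by omega⟩ ⟨2 + 1, by omega⟩ + e ⟨2 + 1, by omega⟩ ⟨2, by omega⟩)) with hB
      have hK2 : ctK (fun s : ℕ => if h : s < 4 then c ⟨s, h⟩ ⟨s, h⟩ * t ^ e ⟨s, h⟩ ⟨s, h⟩ else 1)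
          (fun s : ℕ => -(if h : s + 1 < 4 then c ⟨s, by omega⟩ ⟨s + 1, h⟩ * t ^ e ⟨s, by omega⟩ ⟨s + 1, h⟩ else 0))
          (fun s : ℕ => if h : 1 ≤ s ∧ s < 4 then c ⟨s, h.2⟩ ⟨s - 1, by omega⟩ * t ^ e ⟨s, h.2⟩ ⟨s - 1, by omega⟩ else 0) 2 = A := by
        rw [h2, hL 1 (by omega), hL 0 (by omega), hMN 0 (by omega)]
      have hK4 : ctK (fun s : ℕ => if h : s < 4 then c ⟨s, h⟩ ⟨s, h⟩ * t ^ e ⟨s, h⟩ ⟨s, h⟩ else 1)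
          (fun s : ℕ => -(if h : s + 1 < 4 then c ⟨s, by omega⟩ ⟨s + 1, h⟩ * t ^ e ⟨s, by omega⟩ ⟨s + 1, h⟩ else 0))
          (fun s : ℕ => if h : 1 ≤ s ∧ s < 4 then c ⟨s, h.2⟩ ⟨s - 1, by omega⟩ * t ^ e ⟨s, h.2⟩ ⟨s - 1, by omega⟩ else 0) 4 = B * A := by
        rw [h4, h3, hK2, hMN 2 (by omega), hMN 1 (by omega), hL 3 (by omega), hL 2 (by omega), h12',
          ← hK2, h2, hL 1 (by omega), hL 0 (by omega), hMN 0 (by omega)]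
        ring
      rw [hP, isRoot_iff_ctK_eq_zero c e hband t, hK4]
      have eA : A = 0 ↔ (c ⟨1, by omega⟩ ⟨1, by omega⟩ * c ⟨0, by omega⟩ ⟨0, by omega⟩) *
              t ^ (e ⟨1, by omega⟩ ⟨1, by omega⟩ + e ⟨0, by omega⟩ ⟨0, by omega⟩) =
            (c ⟨0, by omega⟩ ⟨0 + 1, by omega⟩ * c ⟨0 + 1, by omega⟩ ⟨0, by omega⟩) *
              t ^ (e ⟨0, by omega⟩ ⟨0 + 1, by omega⟩ + e ⟨0 + 1, by omega⟩ ⟨0, by omega⟩) := by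
        rw [hA]
        constructor
        · intro h
          have : c ⟨1, by omega⟩ ⟨1, by omega⟩ * c ⟨0, by omega⟩ ⟨0, by omega⟩ *
              t ^ (e ⟨1, by omega⟩ ⟨1, by omega⟩ + e ⟨0, by omega⟩ ⟨0, by omega⟩) =
              c ⟨1, by omega⟩ ⟨1, by omega⟩ * t ^ e ⟨1, by omega⟩ ⟨1, by omega⟩ *
                (c ⟨0, by omega⟩ ⟨0, by omega⟩ * t ^ e ⟨0, by omega⟩ ⟨0, by omega⟩) := by ring
          rw [this]; linarith
        · intro h
          have : c ⟨1, by omega⟩ ⟨1, by omega⟩ * c ⟨0, by omega⟩ ⟨0, by omega⟩ *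
              t ^ (e ⟨1, by omega⟩ ⟨1, by omega⟩ + e ⟨0, by omega⟩ ⟨0, by omega⟩) =
              c ⟨1, by omega⟩ ⟨1, by omega⟩ * t ^ e ⟨1, by omega⟩ ⟨1, by omega⟩ *
                (c ⟨0, by omega⟩ ⟨0, by omega⟩ * t ^ e ⟨0, by omega⟩ ⟨0, by omega⟩) := by ring
          rw [this] at h; linarith
      have eB : B = 0 ↔ (c ⟨3, by omega⟩ ⟨3, by omega⟩ * c ⟨2, by omega⟩ ⟨2, by omega⟩) *
              t ^ (e ⟨3, by omega⟩ ⟨3, by omega⟩ + e ⟨2, by omega⟩ ⟨2, by omega⟩) =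
            (c ⟨2, by omega⟩ ⟨2 + 1, by omega⟩ * c ⟨2 + 1, by omega⟩ ⟨2, by omega⟩) *
              t ^ (e ⟨2, by omega⟩ ⟨2 + 1, by omega⟩ + e ⟨2 + 1, by omega⟩ ⟨2, by omega⟩) := by
        rw [hB]
        constructor
        · intro h
          have : c ⟨3, by omega⟩ ⟨3, by omega⟩ * c ⟨2, by omega⟩ ⟨2, by omega⟩ *
              t ^ (e ⟨3, by omega⟩ ⟨3, by omega⟩ + e ⟨2, by omega⟩ ⟨2, by omega⟩) =
              c ⟨3, by omega⟩ ⟨3, by omega⟩ * t ^ e ⟨3, by omega⟩ ⟨3, by omega⟩ *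
                (c ⟨2, by omega⟩ ⟨2, by omega⟩ * t ^ e ⟨2, by omega⟩ ⟨2, by omega⟩) := by ring
          rw [this]; linarith
        · intro h
          have : c ⟨3, by omega⟩ ⟨3, by omega⟩ * c ⟨2, by omega⟩ ⟨2, by omega⟩ *
              t ^ (e ⟨3, by omega⟩ ⟨3, by omega⟩ + e ⟨2, by omega⟩ ⟨2, by omega⟩) =
              c ⟨3, by omega⟩ ⟨3, by omega⟩ * t ^ e ⟨3, by omega⟩ ⟨3, by omega⟩ *
                (c ⟨2, by omega⟩ ⟨2, by omega⟩ * t ^ e ⟨2, by omega⟩ ⟨2, by omega⟩) := by ring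
          rw [this] at h; linarith
      rw [mul_eq_zero, eA, eB, or_comm]
    have hαA : 0 < c ⟨1, by omega⟩ ⟨1, by omega⟩ * c ⟨0, by omega⟩ ⟨0, by omega⟩ := mul_pos (hpos _) (hpos _)
    have hαB : 0 < c ⟨3, by omega⟩ ⟨3, by omega⟩ * c ⟨2, by omega⟩ ⟨2, by omega⟩ := mul_pos (hpos _) (hpos _)
    have hcardA := card_filter_monomialEq_le_one P hαA (fun t ht h => (hfact t ht).mpr (Or.inl h))
    have hcardB := card_filter_monomialEq_le_one P hαB (fun t ht h => (hfact t ht).mpr (Or.inr h))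
    have hsub : P.roots.toFinset.filter (fun t : ℝ => 0 < t) ⊆
        (P.roots.toFinset.filter (fun t : ℝ => 0 < t)).filter (fun t : ℝ =>
          (c ⟨1, by omega⟩ ⟨1, by omega⟩ * c ⟨0, by omega⟩ ⟨0, by omega⟩) *
              t ^ (e ⟨1, by omega⟩ ⟨1, by omega⟩ + e ⟨0, by omega⟩ ⟨0, by omega⟩) =
            (c ⟨0, by omega⟩ ⟨0 + 1, by omega⟩ * c ⟨0 + 1, by omega⟩ ⟨0, by omega⟩) *
              t ^ (e ⟨0, by omega⟩ ⟨0 + 1, by omega⟩ + e ⟨0 + 1, by omega⟩ ⟨0, by omega⟩)) ∪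
        (P.roots.toFinset.filter (fun t : ℝ => 0 < t)).filter (fun t : ℝ =>
          (c ⟨3, by omega⟩ ⟨3, by omega⟩ * c ⟨2, by omega⟩ ⟨2, by omega⟩) *
              t ^ (e ⟨3, by omega⟩ ⟨3, by omega⟩ + e ⟨2, by omega⟩ ⟨2, by omega⟩) =
            (c ⟨2, by omega⟩ ⟨2 + 1, by omega⟩ * c ⟨2 + 1, by omega⟩ ⟨2, by omega⟩) *
              t ^ (e ⟨2, by omega⟩ ⟨2 + 1, by omega⟩ + e ⟨2 + 1, by omega⟩ ⟨2, by omega⟩)) := by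
      intro t ht
      have ht' := Finset.mem_filter.mp ht
      have hr := ht'.1
      rw [Multiset.mem_toFinset, Polynomial.mem_roots'] at hr
      rw [Finset.mem_union]
      rcases (hfact t ht'.2).mp hr.2 with h | h
      · left; exact Finset.mem_filter.mpr ⟨ht, h⟩
      · right; exact Finset.mem_filter.mpr ⟨ht, h⟩
    exact le_trans (Finset.card_le_card hsub) (le_trans (Finset.card_union_le _ _) (by omega))
  · -- (iv) irreducible
    exact card_posRoots_four_le_four c e hc hband hpos (fun k hk => by
      rcases Nat.lt_or_ge k 1 with h | h
      · obtain rfl : k = 0 := by omega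
        exact h01
      rcases Nat.lt_or_ge k 2 with h' | h'
      · obtain rfl : k = 1 := by omega
        exact h12
      · obtain rfl : k = 2 := by omega
        exact h23)

end ReducibleFour


/-! ### The class range (all sizes): negative pivots are never adjacent, and the pivot before a determinant zero is positive -/

section ClassRange

variable {m : ℕ} (c : Fin m → Fin m → ℝ) (e : Fin m → Fin m → ℕ)

/-- **No two adjacent negative pivots** (all sizes): if the pivot `K_{k+1}/K_k` of a static definite tridiagonal design is negative at a
positive point, the next pivot `K_{k+2}/K_{k+1} = d_{k+2} + w_{k+1}/|K_{k+1}/K_k|` is positive.  Hence (Jacobi) the matrix has at least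
`⌈m/2⌉` positive eigenvalues, and the inertia classes of its determinant zeros range over `0, …, ⌊m/2⌋ − 1` (the counting itself is left
on paper). [this file] -/
theorem pivot_pos_of_prev_neg (hc : ∀ i j, c i j = c j i) (hpos : ∀ i, 0 < c i i) {t : ℝ} (ht : 0 < t) (k : ℕ)
    (hneg : ctK (fun s : ℕ => if h : s < m then c ⟨s, h⟩ ⟨s, h⟩ * t ^ e ⟨s, h⟩ ⟨s, h⟩ else 1)
        (fun s : ℕ => -(if h : s + 1 < m then c ⟨s, by omega⟩ ⟨s + 1, h⟩ * t ^ e ⟨s, by omega⟩ ⟨s + 1, h⟩ else 0))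
        (fun s : ℕ => if h : 1 ≤ s ∧ s < m then c ⟨s, h.2⟩ ⟨s - 1, by omega⟩ * t ^ e ⟨s, h.2⟩ ⟨s - 1, by omega⟩ else 0) (k + 1) /
        ctK (fun s : ℕ => if h : s < m then c ⟨s, h⟩ ⟨s, h⟩ * t ^ e ⟨s, h⟩ ⟨s, h⟩ else 1)
        (fun s : ℕ => -(if h : s + 1 < m then c ⟨s, by omega⟩ ⟨s + 1, h⟩ * t ^ e ⟨s, by omega⟩ ⟨s + 1, h⟩ else 0))
        (fun s : ℕ => if h : 1 ≤ s ∧ s < m then c ⟨s, h.2⟩ ⟨s - 1, by omega⟩ * t ^ e ⟨s, h.2⟩ ⟨s - 1, by omega⟩ else 0) k < 0) :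
    0 < ctK (fun s : ℕ => if h : s < m then c ⟨s, h⟩ ⟨s, h⟩ * t ^ e ⟨s, h⟩ ⟨s, h⟩ else 1)
        (fun s : ℕ => -(if h : s + 1 < m then c ⟨s, by omega⟩ ⟨s + 1, h⟩ * t ^ e ⟨s, by omega⟩ ⟨s + 1, h⟩ else 0))
        (fun s : ℕ => if h : 1 ≤ s ∧ s < m then c ⟨s, h.2⟩ ⟨s - 1, by omega⟩ * t ^ e ⟨s, h.2⟩ ⟨s - 1, by omega⟩ else 0) (k + 2) /
        ctK (fun s : ℕ => if h : s < m then c ⟨s, h⟩ ⟨s, h⟩ * t ^ e ⟨s, h⟩ ⟨s, h⟩ else 1)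
        (fun s : ℕ => -(if h : s + 1 < m then c ⟨s, by omega⟩ ⟨s + 1, h⟩ * t ^ e ⟨s, by omega⟩ ⟨s + 1, h⟩ else 0))
        (fun s : ℕ => if h : 1 ≤ s ∧ s < m then c ⟨s, h.2⟩ ⟨s - 1, by omega⟩ * t ^ e ⟨s, h.2⟩ ⟨s - 1, by omega⟩ else 0) (k + 1) := by
  have hne : ctK (fun s : ℕ => if h : s < m then c ⟨s, h⟩ ⟨s, h⟩ * t ^ e ⟨s, h⟩ ⟨s, h⟩ else 1)
        (fun s : ℕ => -(if h : s + 1 < m then c ⟨s, by omega⟩ ⟨s + 1, h⟩ * t ^ e ⟨s, by omega⟩ ⟨s + 1, h⟩ else 0))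
        (fun s : ℕ => if h : 1 ≤ s ∧ s < m then c ⟨s, h.2⟩ ⟨s - 1, by omega⟩ * t ^ e ⟨s, h.2⟩ ⟨s - 1, by omega⟩ else 0) (k + 1) ≠ 0 := by
    intro h0; rw [h0, zero_div] at hneg; exact lt_irrefl 0 hneg
  rw [ctK_pivot_succ _ _ _ k hne]
  have hL := diagSeq_pos c e hpos ht (k + 1)
  have hw := linkWeight_nonneg c e hc ht k
  have hq : -((fun s : ℕ => -(if h : s + 1 < m then c ⟨s, by omega⟩ ⟨s + 1, h⟩ * t ^ e ⟨s, by omega⟩ ⟨s + 1, h⟩ else 0)) k *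
      (fun s : ℕ => if h : 1 ≤ s ∧ s < m then c ⟨s, h.2⟩ ⟨s - 1, by omega⟩ * t ^ e ⟨s, h.2⟩ ⟨s - 1, by omega⟩ else 0) (k + 1)) /
      (ctK (fun s : ℕ => if h : s < m then c ⟨s, h⟩ ⟨s, h⟩ * t ^ e ⟨s, h⟩ ⟨s, h⟩ else 1)
        (fun s : ℕ => -(if h : s + 1 < m then c ⟨s, by omega⟩ ⟨s + 1, h⟩ * t ^ e ⟨s, by omega⟩ ⟨s + 1, h⟩ else 0))
        (fun s : ℕ => if h : 1 ≤ s ∧ s < m then c ⟨s, h.2⟩ ⟨s - 1, by omega⟩ * t ^ e ⟨s, h.2⟩ ⟨s - 1, by omega⟩ else 0) (k + 1) /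
        ctK (fun s : ℕ => if h : s < m then c ⟨s, h⟩ ⟨s, h⟩ * t ^ e ⟨s, h⟩ ⟨s, h⟩ else 1)
        (fun s : ℕ => -(if h : s + 1 < m then c ⟨s, by omega⟩ ⟨s + 1, h⟩ * t ^ e ⟨s, by omega⟩ ⟨s + 1, h⟩ else 0))
        (fun s : ℕ => if h : 1 ≤ s ∧ s < m then c ⟨s, h.2⟩ ⟨s - 1, by omega⟩ * t ^ e ⟨s, h.2⟩ ⟨s - 1, by omega⟩ else 0) k) ≤ 0 :=
    div_nonpos_iff.mpr (Or.inl ⟨hw, hneg.le⟩)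
  linarith

/-- **At a positive determinant zero the last proper pivot is positive** (all sizes `m = k + 2`): `K_{k+2} = 0` with `K_{k+1} ≠ 0` forces
`K_{k+1}/K_k > 0` — otherwise the last pivot would be positive by `pivot_pos_of_prev_neg` and the determinant non-zero.  So a zero of
class `j` has its `j` negative pivots among the positions `2, …, m − 2`, pairwise non-adjacent. [this file] -/
theorem prevPivot_pos_of_root (hc : ∀ i j, c i j = c j i) (hpos : ∀ i, 0 < c i i) {t : ℝ} (ht : 0 < t) (k : ℕ)
    (hroot : ctK (fun s : ℕ => if h : s < m then c ⟨s, h⟩ ⟨s, h⟩ * t ^ e ⟨s, h⟩ ⟨s, h⟩ else 1)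
        (fun s : ℕ => -(if h : s + 1 < m then c ⟨s, by omega⟩ ⟨s + 1, h⟩ * t ^ e ⟨s, by omega⟩ ⟨s + 1, h⟩ else 0))
        (fun s : ℕ => if h : 1 ≤ s ∧ s < m then c ⟨s, h.2⟩ ⟨s - 1, by omega⟩ * t ^ e ⟨s, h.2⟩ ⟨s - 1, by omega⟩ else 0) (k + 2) = 0)
    (hK : ctK (fun s : ℕ => if h : s < m then c ⟨s, h⟩ ⟨s, h⟩ * t ^ e ⟨s, h⟩ ⟨s, h⟩ else 1)
        (fun s : ℕ => -(if h : s + 1 < m then c ⟨s, by omega⟩ ⟨s + 1, h⟩ * t ^ e ⟨s, by omega⟩ ⟨s + 1, h⟩ else 0))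
        (fun s : ℕ => if h : 1 ≤ s ∧ s < m then c ⟨s, h.2⟩ ⟨s - 1, by omega⟩ * t ^ e ⟨s, h.2⟩ ⟨s - 1, by omega⟩ else 0) (k + 1) ≠ 0)
    (hK' : ctK (fun s : ℕ => if h : s < m then c ⟨s, h⟩ ⟨s, h⟩ * t ^ e ⟨s, h⟩ ⟨s, h⟩ else 1)
        (fun s : ℕ => -(if h : s + 1 < m then c ⟨s, by omega⟩ ⟨s + 1, h⟩ * t ^ e ⟨s, by omega⟩ ⟨s + 1, h⟩ else 0))
        (fun s : ℕ => if h : 1 ≤ s ∧ s < m then c ⟨s, h.2⟩ ⟨s - 1, by omega⟩ * t ^ e ⟨s, h.2⟩ ⟨s - 1, by omega⟩ else 0) k ≠ 0) :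
    0 < ctK (fun s : ℕ => if h : s < m then c ⟨s, h⟩ ⟨s, h⟩ * t ^ e ⟨s, h⟩ ⟨s, h⟩ else 1)
        (fun s : ℕ => -(if h : s + 1 < m then c ⟨s, by omega⟩ ⟨s + 1, h⟩ * t ^ e ⟨s, by omega⟩ ⟨s + 1, h⟩ else 0))
        (fun s : ℕ => if h : 1 ≤ s ∧ s < m then c ⟨s, h.2⟩ ⟨s - 1, by omega⟩ * t ^ e ⟨s, h.2⟩ ⟨s - 1, by omega⟩ else 0) (k + 1) /
        ctK (fun s : ℕ => if h : s < m then c ⟨s, h⟩ ⟨s, h⟩ * t ^ e ⟨s, h⟩ ⟨s, h⟩ else 1)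
        (fun s : ℕ => -(if h : s + 1 < m then c ⟨s, by omega⟩ ⟨s + 1, h⟩ * t ^ e ⟨s, by omega⟩ ⟨s + 1, h⟩ else 0))
        (fun s : ℕ => if h : 1 ≤ s ∧ s < m then c ⟨s, h.2⟩ ⟨s - 1, by omega⟩ * t ^ e ⟨s, h.2⟩ ⟨s - 1, by omega⟩ else 0) k := by
  rcases lt_trichotomy (ctK (fun s : ℕ => if h : s < m then c ⟨s, h⟩ ⟨s, h⟩ * t ^ e ⟨s, h⟩ ⟨s, h⟩ else 1)
        (fun s : ℕ => -(if h : s + 1 < m then c ⟨s, by omega⟩ ⟨s + 1, h⟩ * t ^ e ⟨s, by omega⟩ ⟨s + 1, h⟩ else 0))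
        (fun s : ℕ => if h : 1 ≤ s ∧ s < m then c ⟨s, h.2⟩ ⟨s - 1, by omega⟩ * t ^ e ⟨s, h.2⟩ ⟨s - 1, by omega⟩ else 0) (k + 1) /
      ctK (fun s : ℕ => if h : s < m then c ⟨s, h⟩ ⟨s, h⟩ * t ^ e ⟨s, h⟩ ⟨s, h⟩ else 1)
        (fun s : ℕ => -(if h : s + 1 < m then c ⟨s, by omega⟩ ⟨s + 1, h⟩ * t ^ e ⟨s, by omega⟩ ⟨s + 1, h⟩ else 0))
        (fun s : ℕ => if h : 1 ≤ s ∧ s < m then c ⟨s, h.2⟩ ⟨s - 1, by omega⟩ * t ^ e ⟨s, h.2⟩ ⟨s - 1, by omega⟩ else 0) k) 0 with h | h | h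
  · have := pivot_pos_of_prev_neg c e hc hpos ht k h
    rw [hroot, zero_div] at this
    exact absurd this (lt_irrefl 0)
  · exact absurd h (div_ne_zero hK hK')
  · exact h

end ClassRange

end Summit.ValiantsHypothesis.ValiantsHypothesis.Theorems.KPlusLogSqLaw.DefiniteInterpolation
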